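import Summits.NavierStokesRegularity.FluidComputer.GateBudgetRiccati
import HarnessLib

/-!
# What no tuning can beat, part 27: THE SWITCHING DELAY IS `1/K` — at Tao's amplifier a pinned
# tooth crosses `3/4` at `T + (0.98 ± 0.02)/K` and `19/20` at `T + (1.9 ± 0.1)/K` after clock death

Cell `pub-fluidc`, blueprint seat bp1 (gen 31, fifth item, second third); same namespace and
conventions as parts 1–26 (`GateBudget*.lean`); imports part 26 (`GateBudgetRiccati`: the
Riccati floor and ceiling behind a pin). Modes `0 = a` input, `1 = b` clock, `2 = c` catalyst
(`u = c/ρ²`), `3 = d` transfer, `4 = ã` output; `σ_knob = ρ²/ε`; Tao's amplifier `M = K¹⁰`.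
HONEST FRAMING (verbatim): low prior, high value-of-information experiment on Tao's machine
paradigm; NOT a claim that NS blows up.

THE POINT. Parts 22b/24b/25b time a half-lattice tooth only as "fires `θ` by `T + 1/8`" (the
self-timed window `β/(2ε)` at part 19's clock level `β = ε/4`), a bound blind to `K`. Part 26's
two Riccati comparisons make the delay after clock death a LAW: from the state of a half-lattice
member at its dousing time `T` (clock `b(T) ≤ -ε/4`, residue `u(T) ≤ K⁻¹⁰ + 4e^{-K¹⁰}/K¹⁰`,
pin `|d(T)| ≥ 19931/20000`, output `ã(T) ≤ 1/1000` — parts 19, 22a, 25b) the tooth satisfies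
`ã(t) ≥ r·tanh(rK(t - T))` on `[T, T + 1/8]` with `r = 249/250` (`knob_tooth_rises_of_pin`:
`A′ ≤ 41/K¹⁰`, `r² ≤ (19931/20000)² - A′`), hence `ã ≥ 3/4` from `T + 1/K`, `ã ≥ 19/20` from
`T + 2/K` and `ã ≥ r·tanh(rK/8)` from `T + 1/8` on (the tooth FLOOR of parts 22–25 rises from
`3/4` to `r·tanh(rK/8) → 0.996`); and `ã ≤ 3/4` on `[T, T + 24/(25K)]`, `ã ≤ 19/20` on
`[T, T + 9/(5K)]`
(`knob_tooth_waits_of_clock`, from the ceiling with `ã(T) ≤ 1/1000`). So THE TOOTH CROSSES `3/4`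
AT `T + (0.98 ± 0.02)/K` AND `19/20` AT `T + (1.9 ± 0.1)/K`, for every `K ≥ 16`, every `ε` and
every knob value that pins the member: the comb's teeth all have the same shape, Tao's `tanh`,
traversed at Tao's rate `K` — the knob moves WHEN the clock dies (parts 19–25), never HOW FAST the
tooth then rises. The numerical inputs are `2.7182818283 < e < 2.7182818286`
(`Real.exp_one_gt_d9/lt_d9`), `1 + x ≤ eˣ` and `1 + x + x²/2 ≤ eˣ`: `e^{2r} ≥ 0.992e² ≥ 7.3`,
`e^{4r} ≥ 0.984e⁴ ≥ 53`, `e^{48/25} ≤ e²/1.08 ≤ 6.85`, `e^{18/5} ≤ e⁴/1.48 ≤ 36.9`.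

HONEST LIMITS. (i) The state at `T` is a hypothesis here (part 25b's `knob_member_profile_sharp`
keeps `T` existential and exports only the linear fire clause; a member-state export is the
planned part 28). (ii) The brackets `[24/25, 1]/K` and `[9/5, 2]/K` are what three-decimal
bounds on `e` give, not optimised (the two comparison solutions themselves cross `3/4` at
`Ks ∈ [0.972, 0.984]` and `19/20` at `Ks ∈ [1.83, 1.88]`). (iii) Nothing after `T + 1/8` beyond
monotonicity; no second-pulse exclusion.
(iv) Nothing about Navier–Stokes.
[cite: Tao2016AveragedNS, §5.5 Theorem 5.3, (5.5), (5.6), (b-eq), (c-eq), (tcable)]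
-/

noncomputable section

namespace Summit.NavierStokesRegularity.FluidComputer.GateBudget

open Real Set Filter Topology
open Literature.Analysis.FluidPDE.Tao2016AveragedNS

/-! ## §79 The firing-time law at Tao's amplifier `M = K¹⁰` -/

/-- **THE TOOTH RISES (firing-time law, floor side) at Tao's amplifier.** Along
`rotorCircuit K K¹⁰ ε ρ` from (5.6) (`K ≥ 16`, `0 < ε`, `0 < ρ`): if at some `T ≥ 0` the clock is
dead at part 19's level `b(T) ≤ -ε/4`, the catalyst residue is `u(T) ≤ K⁻¹⁰ + 4e^{-K¹⁰}/K¹⁰` and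
the transfer mode is pinned `|d(T)| ≥ 19931/20000` (the state of a half-lattice member at its
dousing time, parts 19 and 25b), then with `r = 249/250`: `ã(t) ≥ r·tanh(rK(t - T))` on
`[T, T + 1/8]` and `ã ≥ r·tanh(rK/8)` after it (`→ r` as `K → ∞`; parts 22–25's tooth floor
was `3/4`), `ã ≥ 3/4` from `T + 1/K` on and `ã ≥ 19/20` from `T + 2/K` on (§78 with
`m = r² ≤ (19931/20000)² - A′`, `A′ ≤ 41/K¹⁰`; `r·tanh r ≥ 3/4` as `e^{2r} ≥ 0.992e² ≥ 7.3`,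
`r·tanh 2r ≥ 19/20` as `e^{4r} ≥ 0.984e⁴ ≥ 53`, from `e > 2.7182818283`).
[cite: Tao2016AveragedNS, §5.5 Theorem 5.3, (5.5), (5.6), (b-eq), (c-eq), (tcable)] -/
theorem knob_tooth_rises_of_pin {K ε ρ : ℝ} {X : ℝ → Fin 5 → ℝ}
    (hX : ∀ t, HasDerivAt X (RotorKnob.rotorCircuit K (K ^ 10) ε ρ (X t)) t)
    (h0 : X 0 = delayInit) (hK : 16 ≤ K) (hε : 0 < ε) (hρ : 0 < ρ) {T : ℝ} (hT : 0 ≤ T)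
    (hbT : X T 1 ≤ -(ε / 4)) (hcT : X T 2 ≤ (1 / K ^ 10 + 4 * exp (-K ^ 10) / K ^ 10) * ρ ^ 2)
    (hpin : 19931 / 20000 ≤ |X T 3|) :
    (∀ t ∈ Icc T (T + 1 / 8), 249 / 250 * tanh (K * (249 / 250) * (t - T)) ≤ X t 4) ∧
    (∀ t, T + 1 / 8 ≤ t → 249 / 250 * tanh (K * (249 / 250) * (1 / 8)) ≤ X t 4) ∧
    (∀ t, T + 1 / K ≤ t → 3 / 4 ≤ X t 4) ∧ (∀ t, T + 2 / K ≤ t → 19 / 20 ≤ X t 4) := by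
  have hK0 : 0 < K := by linarith
  have hM : 0 < K ^ 10 := by positivity
  have hmon := RotorKnob.rotorCircuit_output_monotone hK0.le hX
  have htanh : ∀ y : ℝ, tanh y = (exp (2 * y) - 1) / (exp (2 * y) + 1) := fun y => by
    rw [Real.tanh_eq, two_mul, exp_add, exp_neg]
    field_simp
  -- the window `β/(2ε) = 1/8` and the afterglow `A′ ≤ 41/K¹⁰ ≤ (19931/20000)² - (249/250)²`
  have h8 : ε / 4 / (2 * ε) = 1 / 8 := by
    field_simp
    ring
  have hK10 : (10 : ℝ) ^ 12 ≤ K ^ 10 :=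
    le_trans (by norm_num) (pow_le_pow_left₀ (by norm_num) hK 10)
  have hmL : (249 / 250 : ℝ) ^ 2 ≤ (19931 / 20000) ^ 2
      - (2 * ε * (1 / K ^ 10 + 4 * exp (-K ^ 10) / K ^ 10) / (K ^ 10 * (ε / 4))
        + exp (-K ^ 10) / K ^ 10) := by
    have he1 : exp (-K ^ 10) ≤ 1 := exp_le_one_iff.2 (by linarith)
    have hA : 2 * ε * (1 / K ^ 10 + 4 * exp (-K ^ 10) / K ^ 10) / (K ^ 10 * (ε / 4))
        + exp (-K ^ 10) / K ^ 10 = (8 * (1 + 4 * exp (-K ^ 10)) / K ^ 10 + exp (-K ^ 10))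
          / K ^ 10 := by
      field_simp
      ring
    have h1 : 8 * (1 + 4 * exp (-K ^ 10)) / K ^ 10 ≤ 40 := by
      rw [div_le_iff₀ hM]
      nlinarith
    have h2 : (8 * (1 + 4 * exp (-K ^ 10)) / K ^ 10 + exp (-K ^ 10)) / K ^ 10 ≤ 1 / 1000 := by
      rw [div_le_div_iff₀ hM (by norm_num)]
      nlinarith
    rw [hA]
    nlinarith
  -- §78: the floor with `m = (249/250)²` on `[T, T + 1/8]`
  have hrate := knob_member_rate_of_pin hX h0 hε hρ hM hK0.le hT (by positivity : 0 < ε / 4) hbT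
    hcT (by norm_num) hpin (by norm_num : (0:ℝ) < (249 / 250) ^ 2) hmL
  rw [h8, Real.sqrt_sq (by norm_num)] at hrate
  have he := Real.exp_one_gt_d9
  have he2 : 7.389 ≤ exp 1 * exp 1 :=
    le_trans (by norm_num) (mul_le_mul he.le he.le (by norm_num) (exp_pos 1).le)
  have he4 : 54.59 ≤ exp 1 * exp 1 * (exp 1 * exp 1) :=
    le_trans (by norm_num) (mul_le_mul he2 he2 (by norm_num) (by positivity))
  have hK8 : 1 / K ≤ (1 : ℝ) / 16 := by
    rw [div_le_div_iff₀ hK0 (by norm_num)]; linarith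
  have hK8' : 2 / K ≤ (1 : ℝ) / 8 := by
    rw [div_le_div_iff₀ hK0 (by norm_num)]; linarith
  have hK1 : (0 : ℝ) < 1 / K := by positivity
  have hK2 : (0 : ℝ) < 2 / K := by positivity
  refine ⟨hrate.1, hrate.2, fun t ht => ?_, fun t ht => ?_⟩
  · -- `ã ≥ 3/4` from `T + 1/K` on: `e^{2r} = e²·e^{-1/125} ≥ 7.389·0.992 ≥ 7.3`
    have ht1 : T + 1 / K ∈ Icc T (T + 1 / 8) := ⟨by linarith, by linarith⟩
    have hfl := hrate.1 (T + 1 / K) ht1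
    rw [show K * (249 / 250) * (T + 1 / K - T) = 249 / 250 by field_simp; ring, htanh] at hfl
    have hexp : 7.3 ≤ exp (2 * (249 / 250 : ℝ)) := by
      have h3 : exp (2 * (249 / 250 : ℝ)) = exp 1 * exp 1 * exp (-(1 / 125)) := by
        simp only [← exp_add]; norm_num
      have h4 : -(1 / 125 : ℝ) + 1 ≤ exp (-(1 / 125)) := add_one_le_exp _
      rw [h3]
      have h5 := mul_le_mul he2 h4 (by norm_num) (by positivity)
      linarith
    have h34 : (3 : ℝ) / 4
        ≤ 249 / 250 * ((exp (2 * (249 / 250)) - 1) / (exp (2 * (249 / 250)) + 1)) := by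
      rw [mul_div_assoc', le_div_iff₀ (by positivity)]
      linarith
    exact h34.trans (hfl.trans (hmon ht))
  · -- `ã ≥ 19/20` from `T + 2/K` on: `e^{4r} = e⁴·e^{-2/125} ≥ 54.59·0.984 ≥ 53`
    have ht1 : T + 2 / K ∈ Icc T (T + 1 / 8) := ⟨by linarith, by linarith⟩
    have hfl := hrate.1 (T + 2 / K) ht1
    rw [show K * (249 / 250) * (T + 2 / K - T) = 249 / 125 by field_simp; ring, htanh] at hfl
    have hexp : 53 ≤ exp (2 * (249 / 125 : ℝ)) := by
      have h3 : exp (2 * (249 / 125 : ℝ))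
          = exp 1 * exp 1 * (exp 1 * exp 1) * exp (-(2 / 125)) := by
        simp only [← exp_add]; norm_num
      have h4 : -(2 / 125 : ℝ) + 1 ≤ exp (-(2 / 125)) := add_one_le_exp _
      rw [h3]
      have h5 := mul_le_mul he4 h4 (by norm_num) (by positivity)
      linarith
    have h95 : (19 : ℝ) / 20
        ≤ 249 / 250 * ((exp (2 * (249 / 125)) - 1) / (exp (2 * (249 / 125)) + 1)) := by
      rw [mul_div_assoc', le_div_iff₀ (by positivity)]
      linarith
    exact h95.trans (hfl.trans (hmon ht))

/-- **THE TOOTH WAITS (firing-time law, ceiling side) at Tao's amplifier.** Along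
`rotorCircuit K K¹⁰ ε ρ` from (5.6) (`K ≥ 16`, `0 < ε`): if at some `T ≥ 0` the clock is dead,
`b(T) ≤ -ε/4`, and the output is still `ã(T) ≤ 1/1000` (parts 19/25b: `ã(T) ≤ 3/K¹⁰ + KΔ`), then
`ã ≤ 3/4` on `[T, T + 24/(25K)]` and `ã ≤ 19/20` on `[T, T + 9/(5K)]` (§78's ceiling on
`[T, T + 1/8]` with `e^{48/25} ≤ e²/1.08 ≤ 6.85` and `e^{18/5} ≤ e⁴/1.48 ≤ 36.9`, from
`e < 2.7182818286`). With `knob_tooth_rises_of_pin`: A PINNED TOOTH CROSSES `3/4` AT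
`T + (0.98 ± 0.02)/K` AND `19/20` AT `T + (1.9 ± 0.1)/K` — the switching delay after clock death is
`~1/K`, independent of the knob `σ` and of `ε`. [cite: Tao2016AveragedNS, §5.5 Theorem 5.3, (5.5),
(b-eq), (energy-con)] -/
theorem knob_tooth_waits_of_clock {K ε ρ : ℝ} {X : ℝ → Fin 5 → ℝ}
    (hX : ∀ t, HasDerivAt X (RotorKnob.rotorCircuit K (K ^ 10) ε ρ (X t)) t)
    (h0 : X 0 = delayInit) (hK : 16 ≤ K) (hε : 0 < ε) {T : ℝ} (hT : 0 ≤ T)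
    (hbT : X T 1 ≤ -(ε / 4)) (heT : X T 4 ≤ 1 / 1000) :
    (∀ t ∈ Icc T (T + 24 / (25 * K)), X t 4 ≤ 3 / 4) ∧
    (∀ t ∈ Icc T (T + 9 / (5 * K)), X t 4 ≤ 19 / 20) := by
  have hK0 : 0 < K := by linarith
  have hM : 0 < K ^ 10 := by positivity
  have hmon := RotorKnob.rotorCircuit_output_monotone hK0.le hX
  have heT0 : 0 ≤ X T 4 := RotorKnob.e_nonneg hX h0 hK0.le hT
  have h8 : ε / 4 / (2 * ε) = 1 / 8 := by
    field_simp
    ring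
  -- §78: the ceiling (ratio law) on `[T, T + 1/8]`
  have hceil : ∀ t ∈ Icc T (T + 1 / 8),
      (1 + X t 4) * (1 - X T 4) ≤ exp (2 * (K * (t - T))) * ((1 + X T 4) * (1 - X t 4)) :=
    fun t ht => by
    have ht' : t ∈ Icc T (T + ε / 4 / (2 * ε)) := by rw [h8]; exact ht
    exact (knob_member_ceiling_selftimed hX h0 hε hM.le hK0.le hT (by positivity) hbT ht').1
  have he' := Real.exp_one_lt_d9
  have he2' : exp 1 * exp 1 ≤ 7.3891 :=
    (mul_le_mul he'.le he'.le (exp_pos 1).le (by norm_num)).trans (by norm_num)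
  have he4' : exp 1 * exp 1 * (exp 1 * exp 1) ≤ 54.6 :=
    (mul_le_mul he2' he2' (by positivity) (by norm_num)).trans (by norm_num)
  refine ⟨fun t ht => ?_, fun t ht => ?_⟩
  · -- `ã ≤ 3/4` on `[T, T + 24/(25K)]`: `e^{2K(t-T)} ≤ e^{48/25} ≤ e²/1.08 ≤ 6.85`
    have h18 : 24 / (25 * K) ≤ (1 : ℝ) / 8 := by
      rw [div_le_div_iff₀ (by positivity) (by norm_num)]; linarith
    have htw : t ∈ Icc T (T + 1 / 8) := ⟨ht.1, by linarith [ht.2]⟩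
    have hprod := hceil t htw
    have hexp : exp (2 * (K * (t - T))) ≤ 6.85 := by
      have h1 : 2 * (K * (t - T)) ≤ 48 / 25 := by
        have h2 : K * (t - T) ≤ K * (24 / (25 * K)) :=
          mul_le_mul_of_nonneg_left (by linarith [ht.2]) hK0.le
        rw [show K * (24 / (25 * K)) = 24 / 25 by field_simp] at h2
        linarith
      have h3 : exp (48 / 25) * exp (2 / 25) = exp 1 * exp 1 := by
        simp only [← exp_add]; norm_num
      have h4 : (2 / 25 : ℝ) + 1 ≤ exp (2 / 25) := add_one_le_exp _
      have h5 : exp (48 / 25) ≤ 6.85 := by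
        have h6 := mul_le_mul_of_nonneg_left h4 (exp_pos (48 / 25 : ℝ)).le
        rw [h3] at h6
        linarith
      exact (exp_le_exp.2 h1).trans h5
    have het : 0 ≤ X t 4 := heT0.trans (hmon ht.1)
    have het1 : X t 4 ≤ 1 := (abs_le.1 (RotorKnob.traj_abs_le_one hX h0 t 4)).2
    have hR := mul_le_mul_of_nonneg_right hexp
      (mul_nonneg (by linarith : 0 ≤ 1 + X T 4) (by linarith : 0 ≤ 1 - X t 4))
    have hfin := hprod.trans hR
    ring_nf at hfin
    nlinarith [mul_nonneg heT0 het]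
  · -- `ã ≤ 19/20` on `[T, T + 9/(5K)]`: `e^{2K(t-T)} ≤ e^{18/5} ≤ e⁴/1.48 ≤ 36.9`
    have h18 : 9 / (5 * K) ≤ (1 : ℝ) / 8 := by
      rw [div_le_div_iff₀ (by positivity) (by norm_num)]; linarith
    have htw : t ∈ Icc T (T + 1 / 8) := ⟨ht.1, by linarith [ht.2]⟩
    have hprod := hceil t htw
    have hexp : exp (2 * (K * (t - T))) ≤ 36.9 := by
      have h1 : 2 * (K * (t - T)) ≤ 18 / 5 := by
        have h2 : K * (t - T) ≤ K * (9 / (5 * K)) :=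
          mul_le_mul_of_nonneg_left (by linarith [ht.2]) hK0.le
        rw [show K * (9 / (5 * K)) = 9 / 5 by field_simp] at h2
        linarith
      have h3 : exp (18 / 5) * exp (2 / 5) = exp 1 * exp 1 * (exp 1 * exp 1) := by
        simp only [← exp_add]; norm_num
      have h4 : 1 + (2 / 5 : ℝ) + (2 / 5) ^ 2 / 2 ≤ exp (2 / 5) :=
        quadratic_le_exp_of_nonneg (by norm_num)
      have h5 : exp (18 / 5) ≤ 36.9 := by
        have h6 := mul_le_mul_of_nonneg_left h4 (exp_pos (18 / 5 : ℝ)).le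
        rw [h3] at h6
        linarith
      exact (exp_le_exp.2 h1).trans h5
    have het : 0 ≤ X t 4 := heT0.trans (hmon ht.1)
    have het1 : X t 4 ≤ 1 := (abs_le.1 (RotorKnob.traj_abs_le_one hX h0 t 4)).2
    have hR := mul_le_mul_of_nonneg_right hexp
      (mul_nonneg (by linarith : 0 ≤ 1 + X T 4) (by linarith : 0 ≤ 1 - X t 4))
    have hfin := hprod.trans hR
    ring_nf at hfin
    nlinarith [mul_nonneg heT0 het]

end Summit.NavierStokesRegularity.FluidComputer.GateBudget
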